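import Mathlib.GroupTheory.Index
import Mathlib.RingTheory.IsTensorProduct
import Literature.LinearAlgebra.BaseChange.EigenvaluesRationalForm
import Literature.LinearAlgebra.Semilinear.CommonEigensystemOrbit
import Literature.NumberTheory.Automorphic.ClozelAlgebraicity
import Literature.NumberTheory.Automorphic.ClozelCArithmetic
import Literature.NumberTheory.Automorphic.ClozelAlgebraicityRatFieldProofs
import Literature.FieldTheory.AlgClosed.AutComplexFiniteIndex
import HarnessLib

/-!
# Clozel's theorem on the Hecke field of a regular algebraic cuspidal `π`: the formal steps (proofs)

Proofs-only companion (theorems, no definitions, no named facts) of `ClozelAlgebraicity.lean`,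
for the named fact `Clozel1990_heckeEigenvalueField` (Clozel 1990, Thm. 3.13, clause "`π_f` is
defined over the number field `ℚ(π_f)`", in the form used by Böckle–Hui 2025, §3.1: the integral
unramified Hecke eigenvalues `t_{v,i} = q_v^{i(n-i)/2} e_i(α_v)` of a cuspidal regular algebraic
`π` on `GL_n(𝔸_K)` lie, for all but finitely many `v`, in ONE number field `E ⊂ ℂ`).

## The printed proof (Clozel 1990, §3.1 and §3.5; Grobner–Raghuram 2014, §7–§8) and what is here

Clozel's source is not held; the architecture below is read from the restatement-with-proofs of
H. Grobner, A. Raghuram, *On some arithmetic properties of automorphic forms of `GL_m` over a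
division algebra*, Int. J. Number Theory 10 (2014) = arXiv:1102.1872 (held text
`paper:arxiv-1102.1872`, §7 "Spaces of automorphic cohomology and rational structures" and §8
"Results on rationality fields", case `D = F`), which re-proves Clozel's results:

1. (Clozel Lemme 3.14; [GR] Thm. 26) `π` cuspidal is regular algebraic iff `π_∞` is cohomological
   w.r.t. some algebraic highest-weight representation `E_μ` of `Res_{K/ℚ} GL_n`.
2. (Clozel §3.5, Borel; [GR] Prop. 41, Franke Thm. 18) `π_f ↪ H^b_cusp(G, E_μ) ↪ H^b_!(S_G, ℰ_μ)
   ⊆ H^b(S_G, ℰ_μ)`, `G(𝔸_f)`-equivariantly; at a fixed level `K_f` the space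
   `H^b(S_G, ℰ_μ)^{K_f} = H^b(S_{K_f}, ℰ_μ)` is FINITE-dimensional and carries the action of the
   unramified Hecke operators `T_{v,i}`, `v ∉ S(K_f)`.
3. (Clozel pp. 122–123; [GR] Lemma 37, Lemma 38) `E_μ` is defined over the number field `ℚ(μ)`,
   hence `H^b(S_{K_f}, ℰ_μ) = H^b_B(S_{K_f}, E_{μ,ℚ(μ)}) ⊗_{ℚ(μ)} ℂ` (Betti cohomology): a
   `ℚ(μ)`-structure preserved by the (ℤ-integral) Hecke operators.
4. Conclusion, in either of two printed forms:
   (a) the `ℚ(μ)`-algebra generated by the `T_{v,i}` in `End_{ℚ(μ)} H^b_B` is finite-dimensional,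
       so its eigencharacter on the line of the spherical vector of `π_f^{K_f}` takes values in a
       finite extension of `ℚ(μ)` — a number field containing every `t_{v,i}`, `v ∉ S(K_f)`
       (Clozel §3.1/§3.5; Shimura 1971 §3.5 for the method; Waldspurger 1985 Cor. I.8.3);
   (b) ([GR] Thm. 50, Hungerford V Lemma 2.9) for `σ ∈ Aut(ℂ/ℚ(μ))` the `σ`-linear automorphism
       `σ^*` of `H^b(S_{K_f}, ℰ_μ)` carries the eigensystem `(t_{v,i})` to `(σ t_{v,i})`, again an
       eigensystem occurring in the SAME finite-dimensional space, so the `Aut(ℂ/ℚ(μ))`-orbit of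
       the eigensystem off `S(K_f)` is finite, its stabiliser has finite index, and its fixed
       field — which contains every `t_{v,i}` — is a number field.

Steps 1–3 (relative Lie algebra cohomology, Franke's/Borel's comparison with the Betti cohomology
of the adelic locally symmetric spaces of `Res_{K/ℚ} GL_n`, and their rational structure) have no
carrier in the tree for a general number field `K` (over `ℚ` only: `GLnCohomology.levelCohomology`
with the UNPROVED fact `GLnCohomology.cuspidalEigenclass_exists`, `CuspidalCohomologyGL.lean`).
This file proves step 4 in both forms, on the tree's carriers, with steps 1–3 as an explicit
hypothesis (no named fact is introduced):

* (the linear algebra of 4(a) — a simultaneous eigenvector in `C ⊗_L V`, `V` finite-dimensional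
  over `L`, of a family of `L`-linear operators has all its eigenvalues in ONE intermediate field
  finite over `L`; for `L ⊆ ℂ` a number field, in a subfield of `ℂ` finite over `ℚ` — is
  `Literature.LinearAlgebra.BaseChange.exists_intermediateField_of_eigenvector_baseChange` /
  `exists_subfield_of_eigenvector_baseChange`, file `LinearAlgebra/BaseChange/EigenvaluesRationalForm`);
* `heckeEigenvalue_mem_subfield_of_rationalEigenvector` (form: eigenvector in `ℂ ⊗_L V`),
  `heckeEigenvalue_mem_subfield_of_rationalStructure` (form: an `L`-structure `f : V → H`,
  `IsBaseChange ℂ f`, on a complex Hecke module `H` — [GR] Lemma 38) and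
  `Clozel1990_heckeEigenvalueField_of_rationalRealisation` — 4(a) on the carriers: a rational
  finite-dimensional Hecke-module realisation of the unramified eigensystem of `π` (steps 1–3)
  gives the conclusion of `Clozel1990_heckeEigenvalueField` for `π`, resp. the fact itself when
  every cuspidal regular algebraic `π` has one;
* `heckeEigenvalue_mem_subfield_of_finite_autOrbit` — 4(b) on the carriers: if the
  `Aut(ℂ/E)`-conjugates (`E` a number field) of the eigensystem of `π` off a finite set `S` of
  places form a finite set, the eigenvalues off `S` lie in a subfield finite over `ℚ`
  (`Complex.finiteDimensional_fixedField_of_finiteIndex` of `AutComplexFiniteIndex`: Artin);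
* `heckeEigenvalue_mem_subfield_of_semilinearAction` and
  `Clozel1990_heckeEigenvalueField_of_semilinearRealisation` — 4(b) in the form the cohomology
  supplies it ([GR] Thm. 50: "`^σΠ'_f ↪ H^q_cusp(G', ^σE_μ)` … `H^q_cusp(G', ^σE_μ)^{K'_f}` is
  finite-dimensional. Therefore `|Aut(ℂ)/𝔖(Π'_f)|` is finite"): a finite-dimensional complex Hecke
  module `H` with, for every `σ ∈ Aut(ℂ/E)`, an injective `σ`-SEMILINEAR map `θ_σ : H → H` commuting
  with the Hecke operators (for `σ` fixing `ℚ(μ)`, `σ^*` on `H^•(S_{K_f}, ℰ_μ ⊗_{ℚ(μ),σ} ℂ) =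
  H^•(S_{K_f}, ℰ_μ)`), and a common eigenvector `x ≠ 0` with the eigenvalues of `π` off `S`: then
  `θ_σ x` has the `σ`-conjugate eigensystem, only finitely many eigensystems occur in `H`
  (`Literature.LinearAlgebra.Semilinear.finite_setOf_common_eigensystem`: eigencharacters of the
  finite-dimensional algebra generated by the operators), so the stabiliser of the eigensystem has
  finite index in `Aut(ℂ/E)` (`exists_stabilizer_finiteIndex_of_semilinear`) and its fixed field is a
  number field containing the eigenvalues — no comparison isomorphism `H = H_L ⊗_L ℂ` is needed;
* bookkeeping: `Clozel1990_heckeEigenvalueField_iff_cArithmetic` — the fact is VERBATIM the tree's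
  `Clozel1990_cArithmetic` (`ClozelCArithmetic.lean`), so either discharge gives the other; and
  `Clozel1990_heckeEigenvalueField.finiteDimensional_ratField` — it implies clause (i) of
  `Clozel1990_regularAlgebraic` (`finiteDimensional_ratField_of_heckeEigenvalue_mem`).

## References

* L. Clozel, *Motifs et formes automorphes: applications du principe de fonctorialité*, in
  Automorphic forms, Shimura varieties, and L-functions I (Ann Arbor 1988), Perspect. Math. 10,
  Academic Press 1990, §3.1, Lemme 3.14, Thm. 3.13 and its proof (§3.5, pp. 122–123).
  [Clozel1990] (not held; read through [GrobnerRaghuram2014])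
* H. Grobner, A. Raghuram, *On some arithmetic properties of automorphic forms of GL_m over a
  division algebra*, Int. J. Number Theory 10 (2014), 963–1013 = arXiv:1102.1872; numbering of the
  arXiv version (held text `paper:arxiv-1102.1872`): §6 Thm. 26, §7 (Lemma 37, Lemma 38,
  Thm. 39 = Franke Thm. 18, Prop. 41, Thm. 42 = Clozel Thm. 3.13, Prop. 45) and §8 (Thm. 50).
  [GrobnerRaghuram2014]
* G. Shimura, *Introduction to the arithmetic theory of automorphic functions* (1971), §3.5.
  [Shimura1971]
* T. W. Hungerford, *Algebra*, GTM 73, Ch. V, Lemma 2.9. [Hungerford1974]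
-/

noncomputable section

open scoped Classical TensorProduct
open NumberField IsDedekindDomain IntermediateField

namespace Literature.NumberTheory.Automorphic

/-! ### Bookkeeping: the fact is the tree's `Clozel1990_cArithmetic`, and implies clause (i) -/

/-- `Clozel1990_heckeEigenvalueField` and `Clozel1990_cArithmetic` (`ClozelCArithmetic.lean`) are
the same statement (syntactically). [cite: Clozel1990, Thm. 3.13] -/
theorem Clozel1990_heckeEigenvalueField_iff_cArithmetic :
    Clozel1990_heckeEigenvalueField ↔ Clozel1990_cArithmetic :=
  Iff.rfl

/-- One direction of `Clozel1990_heckeEigenvalueField_iff_cArithmetic`, for discharging the fact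
from a proof of `Clozel1990_cArithmetic`. [cite: Clozel1990, Thm. 3.13] -/
theorem Clozel1990_heckeEigenvalueField_of_cArithmetic (h : Clozel1990_cArithmetic) :
    Clozel1990_heckeEigenvalueField :=
  h

/-- The other direction of `Clozel1990_heckeEigenvalueField_iff_cArithmetic`. [cite: Clozel1990, Thm. 3.13] -/
theorem Clozel1990_cArithmetic_of_heckeEigenvalueField (h : Clozel1990_heckeEigenvalueField) :
    Clozel1990_cArithmetic :=
  h

/-- Under the fact, clause (i) of Clozel's Thm. 3.13 in the RepData rendering: `ℚ(π_f) = ratField π`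
is a number field (`finiteDimensional_ratField_of_heckeEigenvalue_mem`: `ratField π ⊆ E`).
[cite: Clozel1990, Thm. 3.13 (i)] -/
theorem Clozel1990_heckeEigenvalueField.finiteDimensional_ratField
    (h : Clozel1990_heckeEigenvalueField) {n : ℕ} {K : Type} [Field K] [NumberField K]
    {hcpt : isCompact_glFiniteIntegralLevel n K} (π : CuspidalAutomorphicRepData n K hcpt)
    (hπ : π.1.IsRegularAlgebraic) : FiniteDimensional ℚ (ratField π.1) := by
  obtain ⟨E, hE, hmem⟩ := h n K hcpt π hπ
  haveI := hE
  exact finiteDimensional_ratField_of_heckeEigenvalue_mem π.1 hmem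

/-! ### Step 4(a) on the carriers: a rational Hecke-module realisation gives the Hecke field -/

section Carriers

variable {n : ℕ} {K : Type} [Field K] [NumberField K] {hcpt : isCompact_glFiniteIntegralLevel n K}

/-- **Clozel's Thm. 3.13 (Hecke field) from a rational realisation of the eigensystem.** Let `π`
be an automorphic representation of `GL_n(𝔸_K)`. Suppose there are a subfield `L ⊆ ℂ` finite over
`ℚ`, a finite-dimensional `L`-vector space `V` with `L`-linear operators `T v i`, and a non-zero
`x ∈ ℂ ⊗_L V` such that, for all but finitely many finite places `v`, whenever `π` has Satake
parameter `α` at `v`, `(1 ⊗ T v i) x = t_{v,i} x` with `t_{v,i} = heckeEigenvalueOf n v α i`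
(`0 ≤ i ≤ n`) — in print: `π_f^{K_f} ↪ H^•(S_{K_f}, ℰ_μ) = H^•_B(S_{K_f}, E_{μ,ℚ(μ)}) ⊗_{ℚ(μ)} ℂ`
Hecke-equivariantly (Clozel 1990, Lemme 3.14 and §3.5; Grobner–Raghuram 2014, Lemma 38 and
Prop. 41). Then the unramified Hecke eigenvalues of `π` at all but finitely many places lie in one
subfield of `ℂ` finite over `ℚ`. [cite: Clozel1990, Thm. 3.13 (proof, §3.5)] -/
theorem heckeEigenvalue_mem_subfield_of_rationalEigenvector
    (π : AutomorphicRepData (AutomorphyDatum.gl n K hcpt)) (L : IntermediateField ℚ ℂ)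
    [FiniteDimensional ℚ L] {V : Type*} [AddCommGroup V] [Module L V] [FiniteDimensional L V]
    (T : HeightOneSpectrum (𝓞 K) → ℕ → Module.End L V) {x : ℂ ⊗[L] V} (hx : x ≠ 0)
    (h : ∀ᶠ v : HeightOneSpectrum (𝓞 K) in Filter.cofinite, ∀ α : Multiset ℂ,
      π.HasSatakeParamAt v α → ∀ i ≤ n, (T v i).baseChange ℂ x = heckeEigenvalueOf n v α i • x) :
    ∃ E : Subfield ℂ, FiniteDimensional ℚ E ∧
      ∀ᶠ v : HeightOneSpectrum (𝓞 K) in Filter.cofinite, ∀ α : Multiset ℂ,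
        π.HasSatakeParamAt v α → ∀ i ≤ n, heckeEigenvalueOf n v α i ∈ E := by
  -- index the eigenvalue conditions by the triples `(v, α, i)` at which they hold
  let U : Set (HeightOneSpectrum (𝓞 K)) := {v | ∀ α : Multiset ℂ,
    π.HasSatakeParamAt v α → ∀ i ≤ n, (T v i).baseChange ℂ x = heckeEigenvalueOf n v α i • x}
  have hU : U ∈ Filter.cofinite := h
  let ι := {p : HeightOneSpectrum (𝓞 K) × Multiset ℂ × ℕ //
    p.1 ∈ U ∧ π.HasSatakeParamAt p.1 p.2.1 ∧ p.2.2 ≤ n}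
  obtain ⟨E, hE, hmem⟩ := Literature.LinearAlgebra.BaseChange.exists_subfield_of_eigenvector_baseChange L
    (fun p : ι ↦ T p.1.1 p.1.2.2) (fun p : ι ↦ heckeEigenvalueOf n p.1.1 p.1.2.1 p.1.2.2) hx
    (fun p ↦ p.2.1 p.1.2.1 p.2.2.1 p.1.2.2 p.2.2.2)
  refine ⟨E, hE, ?_⟩
  filter_upwards [hU] with v hv α hα i hi
  exact hmem ⟨(v, α, i), hv, hα, hi⟩

/-- **The same from a rational STRUCTURE on a complex Hecke module** (the shape in which the
cohomology provides it: Grobner–Raghuram 2014, Lemma 38, "`H^q(S_{G'}, ℰ_μ) ≅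
H^q_B(S_{G'}, E_{μ,ℚ(μ)}) ⊗_{ℚ(μ)} ℂ`", a `G'(𝔸_f)`-stable `ℚ(μ)`-structure). Let `H` be a
complex vector space (an `L`-space by restriction of scalars) with `ℂ`-linear operators `S v i`,
`L ⊆ ℂ` finite over `ℚ`, and `f : V → H` an `L`-structure of `H` (`IsBaseChange ℂ f`: the induced
`ℂ ⊗_L V → H` is an isomorphism) with `V` finite-dimensional over `L` and `S v i ∘ f = f ∘ T v i`
for `L`-linear `T v i` (the operators preserve the `L`-structure). If a non-zero `x ∈ H` satisfies
`S v i x = t_{v,i} x` (`t_{v,i} = heckeEigenvalueOf n v α i`) at all but finitely many `v`, then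
the `t_{v,i}` at all but finitely many places lie in one subfield of `ℂ` finite over `ℚ`: pull
`x` back along `IsBaseChange.equiv` to `ℂ ⊗_L V`, where `S v i` becomes `(T v i).baseChange ℂ`,
and apply `heckeEigenvalue_mem_subfield_of_rationalEigenvector`.
[cite: GrobnerRaghuram2014, Lemma 38 (arXiv:1102.1872 numbering)] [cite: Clozel1990, Thm. 3.13 (proof, §3.5)] -/
theorem heckeEigenvalue_mem_subfield_of_rationalStructure
    (π : AutomorphicRepData (AutomorphyDatum.gl n K hcpt)) (L : IntermediateField ℚ ℂ)
    [FiniteDimensional ℚ L] {V : Type*} [AddCommGroup V] [Module L V] [FiniteDimensional L V]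
    {H : Type*} [AddCommGroup H] [Module ℂ H] {f : V →ₗ[L] H} (hf : IsBaseChange ℂ f)
    (S : HeightOneSpectrum (𝓞 K) → ℕ → Module.End ℂ H)
    (T : HeightOneSpectrum (𝓞 K) → ℕ → Module.End L V)
    (hST : ∀ v i (m : V), S v i (f m) = f (T v i m)) {x : H} (hx : x ≠ 0)
    (h : ∀ᶠ v : HeightOneSpectrum (𝓞 K) in Filter.cofinite, ∀ α : Multiset ℂ,
      π.HasSatakeParamAt v α → ∀ i ≤ n, S v i x = heckeEigenvalueOf n v α i • x) :
    ∃ E : Subfield ℂ, FiniteDimensional ℚ E ∧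
      ∀ᶠ v : HeightOneSpectrum (𝓞 K) in Filter.cofinite, ∀ α : Multiset ℂ,
        π.HasSatakeParamAt v α → ∀ i ≤ n, heckeEigenvalueOf n v α i ∈ E := by
  -- transport along `e : ℂ ⊗_L V ≃ H`; the operators `S v i` pull back to `(T v i).baseChange ℂ`
  set e := hf.equiv with he
  have hcomm : ∀ v i (z : ℂ ⊗[L] V), e ((T v i).baseChange ℂ z) = S v i (e z) := by
    intro v i z
    induction z using TensorProduct.induction_on with
    | zero => rw [map_zero, map_zero, map_zero]
    | tmul c m =>
      rw [LinearMap.baseChange_tmul, he, IsBaseChange.equiv_tmul, IsBaseChange.equiv_tmul,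
        LinearMap.map_smul_of_tower, hST]
    | add z w hz hw => rw [map_add, map_add, hz, hw, map_add, map_add]
  have hy : e.symm x ≠ 0 := fun h0 ↦ hx (by simpa using congrArg e h0)
  refine heckeEigenvalue_mem_subfield_of_rationalEigenvector π L T hy ?_
  filter_upwards [h] with v hv α hα i hi
  apply e.injective
  rw [hcomm, LinearEquiv.apply_symm_apply, hv α hα i hi, LinearEquiv.map_smul,
    LinearEquiv.apply_symm_apply]

/-- **`Clozel1990_heckeEigenvalueField` from the cohomological realisation (steps 1–3 of the
printed proof as a hypothesis).** If every cuspidal regular algebraic `π` on every `GL_n(𝔸_K)`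
admits a rational finite-dimensional realisation of its unramified Hecke eigensystem at almost all
places (a number field `L ⊆ ℂ`, a finite-dimensional `L`-space `V` with operators `T v i`, and a
common eigenvector `x ≠ 0` in `ℂ ⊗_L V` with the eigenvalues `t_{v,i}` of `π`; in print
`π_f ↪ H^•_cusp ⊆ H^•(S_G, ℰ_μ) = H^•_B(S_G, E_{μ,ℚ(μ)}) ⊗ ℂ`: Clozel 1990, Lemme 3.14 and §3.5,
pp. 122–123; Grobner–Raghuram 2014, Thm. 26, Lemma 38, Prop. 41), then the named fact holds.
[cite: Clozel1990, Thm. 3.13 (proof, §3.5)] -/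
theorem Clozel1990_heckeEigenvalueField_of_rationalRealisation
    (hreal : ∀ (n : ℕ) (K : Type) [Field K] [NumberField K]
      (hcpt : isCompact_glFiniteIntegralLevel n K) (π : CuspidalAutomorphicRepData n K hcpt),
      π.1.IsRegularAlgebraic →
      ∃ (L : IntermediateField ℚ ℂ) (_ : FiniteDimensional ℚ L) (V : Type) (_ : AddCommGroup V)
        (_ : Module L V) (_ : FiniteDimensional L V)
        (T : HeightOneSpectrum (𝓞 K) → ℕ → Module.End L V) (x : ℂ ⊗[L] V), x ≠ 0 ∧
        ∀ᶠ v : HeightOneSpectrum (𝓞 K) in Filter.cofinite, ∀ α : Multiset ℂ,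
          π.1.HasSatakeParamAt v α → ∀ i ≤ n,
            (T v i).baseChange ℂ x = heckeEigenvalueOf n v α i • x) :
    Clozel1990_heckeEigenvalueField := by
  intro n K _ _ hcpt π hπ
  obtain ⟨L, hL, V, _, _, hV, T, x, hx, h⟩ := hreal n K hcpt π hπ
  haveI := hL
  haveI := hV
  exact heckeEigenvalue_mem_subfield_of_rationalEigenvector π.1 L T hx h

end Carriers

/-! ### Step 4(b) on the carriers: finitely many `Aut(ℂ/E)`-conjugates of the eigensystem -/

section Orbit

variable {n : ℕ} {K : Type} [Field K] [NumberField K] {hcpt : isCompact_glFiniteIntegralLevel n K}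

/-- **Finitely many conjugates of the eigensystem give a number field containing the
eigenvalues** (Grobner–Raghuram 2014, Thm. 50, after Clozel 1990, §3.1 and Thm. 3.13 (i);
Hungerford V, Lemma 2.9). Let `E ⊆ ℂ` be finite over `ℚ`, `S` a finite set of finite places, and
suppose the `Aut(ℂ/E)`-conjugates of the unramified Hecke eigensystem of `π` off `S` lie in a
finite set `F` of systems: for every `σ ∈ Aut(ℂ/E)` some `f ∈ F` has `σ(t_{v,i}) = f v i` for all
`v ∉ S`, all Satake parameters `α` of `π` at `v` and all `i ≤ n` (in print: `^σπ_f` is again a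
constituent of the finite-dimensional `H^•(S_{K_f}, ^σℰ_μ)`, `K_f` fixed). Then the stabiliser of
the eigensystem off `S` has finite index in `Aut(ℂ/E)`, so its fixed field is finite over `ℚ`
(`Complex.finiteDimensional_fixedField_of_finiteIndex`) and contains every `t_{v,i}`, `v ∉ S`.
[cite: GrobnerRaghuram2014, Thm. 50 (arXiv:1102.1872 numbering)] [cite: Clozel1990, §3.1 and Thm. 3.13 (i)] -/
theorem heckeEigenvalue_mem_subfield_of_finite_autOrbit
    (π : AutomorphicRepData (AutomorphyDatum.gl n K hcpt)) (E : IntermediateField ℚ ℂ)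
    [FiniteDimensional ℚ E] (S : Set (HeightOneSpectrum (𝓞 K)))
    (F : Finset (HeightOneSpectrum (𝓞 K) → ℕ → ℂ))
    (horbit : ∀ σ : ℂ ≃ₐ[ℚ] ℂ, σ ∈ E.fixingSubgroup → ∃ f ∈ F, ∀ v ∉ S, ∀ α : Multiset ℂ,
      π.HasSatakeParamAt v α → ∀ i ≤ n, σ (heckeEigenvalueOf n v α i) = f v i) :
    ∃ E' : Subfield ℂ, FiniteDimensional ℚ E' ∧ ∀ v ∉ S, ∀ α : Multiset ℂ,
      π.HasSatakeParamAt v α → ∀ i ≤ n, heckeEigenvalueOf n v α i ∈ E' := by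
  -- the stabiliser of the eigensystem off `S`
  let H : Subgroup (ℂ ≃ₐ[ℚ] ℂ) :=
    { carrier := {σ | ∀ v ∉ S, ∀ α : Multiset ℂ, π.HasSatakeParamAt v α → ∀ i ≤ n,
        σ (heckeEigenvalueOf n v α i) = heckeEigenvalueOf n v α i}
      one_mem' := fun _ _ _ _ _ _ ↦ rfl
      mul_mem' := fun {σ τ} hσ hτ v hv α hα i hi ↦ by
        rw [AlgEquiv.mul_apply, hτ v hv α hα i hi, hσ v hv α hα i hi]
      inv_mem' := fun {σ} hσ v hv α hα i hi ↦ by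
        conv_lhs => rw [← hσ v hv α hα i hi]
        exact σ.symm_apply_apply _ }
  have hmemH : ∀ {σ : ℂ ≃ₐ[ℚ] ℂ}, σ ∈ H ↔ ∀ v ∉ S, ∀ α : Multiset ℂ, π.HasSatakeParamAt v α →
      ∀ i ≤ n, σ (heckeEigenvalueOf n v α i) = heckeEigenvalueOf n v α i := fun {σ} ↦ Iff.rfl
  -- the conjugated eigensystem off `S`, as a function of `σ ∈ G = Aut(ℂ/E)`
  set G : Subgroup (ℂ ≃ₐ[ℚ] ℂ) := E.fixingSubgroup
  let g : G → (HeightOneSpectrum (𝓞 K) → Multiset ℂ → ℕ → ℂ) := fun σ v α i ↦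
    if v ∉ S ∧ π.HasSatakeParamAt v α ∧ i ≤ n then (σ : ℂ ≃ₐ[ℚ] ℂ) (heckeEigenvalueOf n v α i)
    else 0
  -- two automorphisms with the same conjugated system differ by an element of the stabiliser
  have hg : ∀ σ τ : G, g σ = g τ ↔ ((σ : ℂ ≃ₐ[ℚ] ℂ)⁻¹ * τ) ∈ H := by
    intro σ τ
    constructor
    · intro hστ v hv α hα i hi
      have h1 := congrFun (congrFun (congrFun hστ v) α) i
      simp only [g, hv, hα, hi, not_false_eq_true, and_self, ↓reduceIte] at h1
      rw [AlgEquiv.mul_apply, ← h1]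
      exact (σ : ℂ ≃ₐ[ℚ] ℂ).symm_apply_apply _
    · intro hστ
      funext v α i
      by_cases hc : v ∉ S ∧ π.HasSatakeParamAt v α ∧ i ≤ n
      · simp only [g, hc, not_false_eq_true, and_self, ↓reduceIte]
        have h1 := hστ v hc.1 α hc.2.1 i hc.2.2
        rw [AlgEquiv.mul_apply] at h1
        -- `h1 : σ⁻¹ (τ t) = t`
        have h2 := congrArg (σ : ℂ ≃ₐ[ℚ] ℂ) h1
        rw [show ((σ : ℂ ≃ₐ[ℚ] ℂ)⁻¹ : ℂ ≃ₐ[ℚ] ℂ) = (σ : ℂ ≃ₐ[ℚ] ℂ).symm from rfl,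
          AlgEquiv.apply_symm_apply] at h2
        exact h2.symm
      · simp only [g, hc, ↓reduceIte]
  -- the range of `g` is finite (it consists of systems cut out of `F`)
  have hrange : (Set.range g).Finite := by
    refine (F.finite_toSet.image fun (f : HeightOneSpectrum (𝓞 K) → ℕ → ℂ) (v :
      HeightOneSpectrum (𝓞 K)) (α : Multiset ℂ) (i : ℕ) ↦
        if v ∉ S ∧ π.HasSatakeParamAt v α ∧ i ≤ n then f v i else 0).subset ?_
    rintro _ ⟨σ, rfl⟩
    obtain ⟨f, hf, hfσ⟩ := horbit σ σ.2
    refine ⟨f, hf, ?_⟩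
    funext v α i
    by_cases hc : v ∉ S ∧ π.HasSatakeParamAt v α ∧ i ≤ n
    · simp only [g, hc, not_false_eq_true, and_self, ↓reduceIte]
      exact (hfσ v hc.1 α hc.2.1 i hc.2.2).symm
    · simp only [g, hc, ↓reduceIte]
  -- hence the stabiliser has finite index in `G`
  have hfi : ((H ⊓ G).subgroupOf G).FiniteIndex := by
    haveI : Finite (Set.range g) := hrange.to_subtype
    set H' : Subgroup G := (H ⊓ G).subgroupOf G with hH'
    have hmemH' : ∀ σ : G, σ ∈ H' ↔ (σ : ℂ ≃ₐ[ℚ] ℂ) ∈ H := fun σ ↦ by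
      rw [hH', Subgroup.mem_subgroupOf, Subgroup.mem_inf]
      exact ⟨fun h ↦ h.1, fun h ↦ ⟨h, σ.2⟩⟩
    let φ : G ⧸ H' → Set.range g := Quotient.lift (s := QuotientGroup.leftRel H')
      (fun σ ↦ ⟨g σ, σ, rfl⟩) (fun σ τ hστ ↦ by
        have h1 : σ⁻¹ * τ ∈ H' := QuotientGroup.leftRel_apply.mp hστ
        exact Subtype.ext ((hg σ τ).mpr ((hmemH' _).mp h1)))
    haveI : Finite (G ⧸ H') := by
      refine Finite.of_injective φ ?_
      intro a b hab
      induction a using Quotient.inductionOn with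
      | h σ =>
        induction b using Quotient.inductionOn with
        | h τ =>
          have hστ : g σ = g τ := congrArg Subtype.val hab
          have h1 : σ⁻¹ * τ ∈ H' := (hmemH' _).mpr ((hg σ τ).mp hστ)
          exact Quotient.sound (QuotientGroup.leftRel_apply.mpr h1)
    exact Subgroup.finiteIndex_of_finite_quotient
  -- so its fixed field is finite over `ℚ`, and it contains the eigenvalues off `S`
  haveI : FiniteDimensional ℚ (fixedField H) :=
    Literature.FieldTheory.AlgClosed.Complex.finiteDimensional_fixedField_of_finiteIndex H E hfi
  obtain ⟨E', hE', hiff⟩ :=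
    Literature.LinearAlgebra.BaseChange.exists_subfield_finiteDimensional_iff_mem (fixedField H)
  refine ⟨E', hE', fun v hv α hα i hi ↦ (hiff _).mpr ?_⟩
  rw [mem_fixedField_iff]
  intro σ hσ
  exact hmemH.mp hσ v hv α hα i hi

/-- `heckeEigenvalue_mem_subfield_of_finite_autOrbit` with a finite exceptional set `S`,
conclusion at all but finitely many places (the shape of `Clozel1990_heckeEigenvalueField`).
[cite: GrobnerRaghuram2014, Thm. 50 (arXiv:1102.1872 numbering)] -/
theorem heckeEigenvalue_mem_subfield_cofinite_of_finite_autOrbit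
    (π : AutomorphicRepData (AutomorphyDatum.gl n K hcpt)) (E : IntermediateField ℚ ℂ)
    [FiniteDimensional ℚ E] {S : Set (HeightOneSpectrum (𝓞 K))} (hS : S.Finite)
    (F : Finset (HeightOneSpectrum (𝓞 K) → ℕ → ℂ))
    (horbit : ∀ σ : ℂ ≃ₐ[ℚ] ℂ, σ ∈ E.fixingSubgroup → ∃ f ∈ F, ∀ v ∉ S, ∀ α : Multiset ℂ,
      π.HasSatakeParamAt v α → ∀ i ≤ n, σ (heckeEigenvalueOf n v α i) = f v i) :
    ∃ E' : Subfield ℂ, FiniteDimensional ℚ E' ∧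
      ∀ᶠ v : HeightOneSpectrum (𝓞 K) in Filter.cofinite, ∀ α : Multiset ℂ,
        π.HasSatakeParamAt v α → ∀ i ≤ n, heckeEigenvalueOf n v α i ∈ E' := by
  obtain ⟨E', hE', hmem⟩ := heckeEigenvalue_mem_subfield_of_finite_autOrbit π E S F horbit
  refine ⟨E', hE', ?_⟩
  have hSc : Sᶜ ∈ Filter.cofinite := Filter.mem_cofinite.mpr (by simpa using hS)
  filter_upwards [hSc] with v hv
  exact hmem v hv

end Orbit

/-! ### Step 4(b) from a semilinear `Aut(ℂ/E)`-action on a finite-dimensional Hecke module -/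

section Semilinear

variable {n : ℕ} {K : Type} [Field K] [NumberField K] {hcpt : isCompact_glFiniteIntegralLevel n K}

/-- **Clozel's Thm. 3.13 (Hecke field) from a semilinear `Aut(ℂ/E)`-action on a finite-dimensional
Hecke module** — the mechanism of Grobner–Raghuram 2014, Thm. 50 (after Clozel 1990, §3.1 and the
proof of Thm. 3.13): "for any automorphism `σ ∈ Aut(ℂ)`, `^σΠ'_f` is the finite part of a cuspidal
automorphic representation which has non-vanishing cohomology with respect to `^σE_μ` … we hence
obtain inclusions `^σΠ'_f ↪ H^q_cusp(G', ^σE_μ)` … for each `σ`, `H^q_cusp(G', ^σE_μ)^{K'_f}` is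
finite-dimensional. Therefore `|Aut(ℂ)/𝔖(Π'_f)|` is finite. By [Hungerford], V Lem. 2.9,
`|Aut(ℂ)/𝔖(Π'_f)|` is an upper bound for `[ℚ(Π'_f) : ℚ]`." On the carriers: let `E ⊆ ℂ` be finite
over `ℚ` (in print `ℚ(μ)`), `H` a finite-dimensional complex vector space with operators `Sop v i`
(in print `H^q(S_{K'_f}, ℰ_μ)` with its unramified Hecke operators), and for every `σ ∈ Aut(ℂ/E)` an
injective `σ`-semilinear map `θ_σ : H → H` commuting with the `Sop v i` (in print `σ^*`, induced on
Betti cohomology by `ℰ_μ ⊗_{ℚ(μ),σ} ℂ = ℰ_μ ⊗_{ℚ(μ)} ℂ`; the Hecke correspondences are defined over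
`ℚ`). If a non-zero `x ∈ H` has `Sop v i x = t_{v,i} x` for all `v ∉ S`, all Satake parameters `α`
of `π` at `v` and all `i ≤ n` (`t_{v,i} = heckeEigenvalueOf n v α i`), then: `θ_σ x ≠ 0` is a common
eigenvector with the system `(σ t_{v,i})`; only finitely many systems of common eigenvectors occur in
`H` (`Literature.LinearAlgebra.Semilinear.finite_setOf_common_eigensystem`); hence the stabiliser of
`(t_{v,i})_{v ∉ S}` has finite index in `Aut(ℂ/E)`
(`Literature.LinearAlgebra.Semilinear.exists_stabilizer_finiteIndex_of_semilinear`), its fixed field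
in `ℂ` is finite over `ℚ` (`Complex.finiteDimensional_fixedField_of_finiteIndex`, Artin) and contains
every `t_{v,i}`, `v ∉ S`. No comparison isomorphism with a rational form of `H` is used.
[cite: GrobnerRaghuram2014, Thm. 50 (arXiv:1102.1872 numbering)] [cite: Clozel1990, §3.1 and Thm. 3.13 (proof, §3.5)] -/
theorem heckeEigenvalue_mem_subfield_of_semilinearAction
    (π : AutomorphicRepData (AutomorphyDatum.gl n K hcpt)) (E : IntermediateField ℚ ℂ)
    [FiniteDimensional ℚ E] (S : Set (HeightOneSpectrum (𝓞 K)))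
    {H : Type*} [AddCommGroup H] [Module ℂ H] [FiniteDimensional ℂ H]
    (Sop : HeightOneSpectrum (𝓞 K) → ℕ → Module.End ℂ H)
    (θ : ∀ σ : E.fixingSubgroup, H →ₛₗ[((σ : ℂ ≃ₐ[ℚ] ℂ) : ℂ →+* ℂ)] H)
    (hθS : ∀ (σ : E.fixingSubgroup) (v : HeightOneSpectrum (𝓞 K)) (i : ℕ) (z : H),
      θ σ (Sop v i z) = Sop v i (θ σ z))
    (hθinj : ∀ σ : E.fixingSubgroup, Function.Injective (θ σ))
    {x : H} (hx : x ≠ 0)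
    (h : ∀ v ∉ S, ∀ α : Multiset ℂ, π.HasSatakeParamAt v α → ∀ i ≤ n,
      Sop v i x = heckeEigenvalueOf n v α i • x) :
    ∃ E' : Subfield ℂ, FiniteDimensional ℚ E' ∧ ∀ v ∉ S, ∀ α : Multiset ℂ,
      π.HasSatakeParamAt v α → ∀ i ≤ n, heckeEigenvalueOf n v α i ∈ E' := by
  -- index the eigenvalue conditions by the triples `(v, α, i)` at which they hold
  let ι := {p : HeightOneSpectrum (𝓞 K) × Multiset ℂ × ℕ //
    p.1 ∉ S ∧ π.HasSatakeParamAt p.1 p.2.1 ∧ p.2.2 ≤ n}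
  let S' : ι → Module.End ℂ H := fun p ↦ Sop p.1.1 p.1.2.2
  let χ : ι → ℂ := fun p ↦ heckeEigenvalueOf n p.1.1 p.1.2.1 p.1.2.2
  have hχ : ∀ p : ι, S' p x = χ p • x := fun p ↦ h p.1.1 p.2.1 p.1.2.1 p.2.2.1 p.1.2.2 p.2.2.2
  -- the stabiliser of the eigensystem has finite index in `G = Aut(ℂ/E)`
  obtain ⟨Hs, hHs, hfi⟩ :=
    Literature.LinearAlgebra.Semilinear.exists_stabilizer_finiteIndex_of_semilinear S' χ hx hχ
      (G := E.fixingSubgroup) (fun σ ↦ ((σ : ℂ ≃ₐ[ℚ] ℂ) : ℂ →+* ℂ)) (fun _ ↦ rfl)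
      (fun _ _ _ ↦ rfl) θ (fun σ p z ↦ hθS σ p.1.1 p.1.2.2 z) hθinj
  -- the same stabiliser, as a subgroup of `Aut(ℂ)`
  let Hst : Subgroup (ℂ ≃ₐ[ℚ] ℂ) :=
    { carrier := {σ | ∀ p : ι, σ (χ p) = χ p}
      one_mem' := fun _ ↦ rfl
      mul_mem' := fun {σ τ} hσ hτ p ↦ by rw [AlgEquiv.mul_apply, hτ p, hσ p]
      inv_mem' := fun {σ} hσ p ↦ by
        conv_lhs => rw [← hσ p]
        exact σ.symm_apply_apply _ }
  have hmemHst : ∀ {σ : ℂ ≃ₐ[ℚ] ℂ}, σ ∈ Hst ↔ ∀ p : ι, σ (χ p) = χ p := fun {σ} ↦ Iff.rfl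
  have hsub : (Hst ⊓ E.fixingSubgroup).subgroupOf E.fixingSubgroup = Hs := by
    ext σ
    rw [Subgroup.mem_subgroupOf, Subgroup.mem_inf, hHs]
    exact ⟨fun h1 p ↦ h1.1 p, fun h1 ↦ ⟨fun p ↦ h1 p, σ.2⟩⟩
  have hfi' : ((Hst ⊓ E.fixingSubgroup).subgroupOf E.fixingSubgroup).FiniteIndex := by
    rw [hsub]
    exact hfi
  -- so its fixed field is finite over `ℚ`, and it contains the eigenvalues off `S`
  haveI : FiniteDimensional ℚ (fixedField Hst) :=
    Literature.FieldTheory.AlgClosed.Complex.finiteDimensional_fixedField_of_finiteIndex Hst E hfi'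
  obtain ⟨E', hE', hiff⟩ :=
    Literature.LinearAlgebra.BaseChange.exists_subfield_finiteDimensional_iff_mem (fixedField Hst)
  refine ⟨E', hE', fun v hv α hα i hi ↦ (hiff _).mpr ?_⟩
  rw [mem_fixedField_iff]
  intro σ hσ
  exact hmemHst.mp hσ ⟨(v, α, i), hv, hα, hi⟩

/-- `heckeEigenvalue_mem_subfield_of_semilinearAction` with a finite exceptional set `S`,
conclusion at all but finitely many places (the shape of `Clozel1990_heckeEigenvalueField`).
[cite: GrobnerRaghuram2014, Thm. 50 (arXiv:1102.1872 numbering)] -/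
theorem heckeEigenvalue_mem_subfield_cofinite_of_semilinearAction
    (π : AutomorphicRepData (AutomorphyDatum.gl n K hcpt)) (E : IntermediateField ℚ ℂ)
    [FiniteDimensional ℚ E] {S : Set (HeightOneSpectrum (𝓞 K))} (hS : S.Finite)
    {H : Type*} [AddCommGroup H] [Module ℂ H] [FiniteDimensional ℂ H]
    (Sop : HeightOneSpectrum (𝓞 K) → ℕ → Module.End ℂ H)
    (θ : ∀ σ : E.fixingSubgroup, H →ₛₗ[((σ : ℂ ≃ₐ[ℚ] ℂ) : ℂ →+* ℂ)] H)
    (hθS : ∀ (σ : E.fixingSubgroup) (v : HeightOneSpectrum (𝓞 K)) (i : ℕ) (z : H),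
      θ σ (Sop v i z) = Sop v i (θ σ z))
    (hθinj : ∀ σ : E.fixingSubgroup, Function.Injective (θ σ))
    {x : H} (hx : x ≠ 0)
    (h : ∀ v ∉ S, ∀ α : Multiset ℂ, π.HasSatakeParamAt v α → ∀ i ≤ n,
      Sop v i x = heckeEigenvalueOf n v α i • x) :
    ∃ E' : Subfield ℂ, FiniteDimensional ℚ E' ∧
      ∀ᶠ v : HeightOneSpectrum (𝓞 K) in Filter.cofinite, ∀ α : Multiset ℂ,
        π.HasSatakeParamAt v α → ∀ i ≤ n, heckeEigenvalueOf n v α i ∈ E' := by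
  obtain ⟨E', hE', hmem⟩ :=
    heckeEigenvalue_mem_subfield_of_semilinearAction π E S Sop θ hθS hθinj hx h
  refine ⟨E', hE', ?_⟩
  have hSc : Sᶜ ∈ Filter.cofinite := Filter.mem_cofinite.mpr (by simpa using hS)
  filter_upwards [hSc] with v hv
  exact hmem v hv

/-- **`Clozel1990_heckeEigenvalueField` from the cohomological realisation with its semilinear
`Aut(ℂ)`-symmetries (steps 1–3 of the printed proof as a hypothesis, in the form of
Grobner–Raghuram 2014, Thm. 50).** If every cuspidal regular algebraic `π` on every `GL_n(𝔸_K)`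
admits: a subfield `E ⊆ ℂ` finite over `ℚ` (in print `ℚ(μ)`, `μ` the highest weight attached to
the infinity type by Lemme 3.14), a finite set `S` of finite places, a finite-dimensional complex
vector space `H` with operators `Sop v i` and injective `σ`-semilinear maps `θ_σ` (`σ ∈ Aut(ℂ/E)`)
commuting with them (in print `H^b(S_{K_f}, ℰ_μ)` with the unramified Hecke operators and `σ^*`),
and a non-zero common eigenvector `x` with `Sop v i x = t_{v,i} x` off `S` (in print the image of a
spherical vector of `π_f^{K_f}` under `π_f ↪ H^b_cusp ⊆ H^b(S_{K_f}, ℰ_μ)`: Clozel 1990, Lemme 3.14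
and §3.5; Grobner–Raghuram 2014, Thm. 26 and Prop. 41), then the named fact holds
(`heckeEigenvalue_mem_subfield_cofinite_of_semilinearAction`).
[cite: GrobnerRaghuram2014, Thm. 50 (arXiv:1102.1872 numbering)] [cite: Clozel1990, Thm. 3.13 (proof, §3.5)] -/
theorem Clozel1990_heckeEigenvalueField_of_semilinearRealisation
    (hreal : ∀ (n : ℕ) (K : Type) [Field K] [NumberField K]
      (hcpt : isCompact_glFiniteIntegralLevel n K) (π : CuspidalAutomorphicRepData n K hcpt),
      π.1.IsRegularAlgebraic →
      ∃ (E : IntermediateField ℚ ℂ) (_ : FiniteDimensional ℚ E)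
        (S : Set (HeightOneSpectrum (𝓞 K))) (_ : S.Finite)
        (H : Type) (_ : AddCommGroup H) (_ : Module ℂ H) (_ : FiniteDimensional ℂ H)
        (Sop : HeightOneSpectrum (𝓞 K) → ℕ → Module.End ℂ H)
        (θ : ∀ σ : E.fixingSubgroup, H →ₛₗ[((σ : ℂ ≃ₐ[ℚ] ℂ) : ℂ →+* ℂ)] H),
        (∀ (σ : E.fixingSubgroup) (v : HeightOneSpectrum (𝓞 K)) (i : ℕ) (z : H),
          θ σ (Sop v i z) = Sop v i (θ σ z)) ∧
        (∀ σ : E.fixingSubgroup, Function.Injective (θ σ)) ∧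
        ∃ x : H, x ≠ 0 ∧ ∀ v ∉ S, ∀ α : Multiset ℂ, π.1.HasSatakeParamAt v α → ∀ i ≤ n,
          Sop v i x = heckeEigenvalueOf n v α i • x) :
    Clozel1990_heckeEigenvalueField := by
  intro n K _ _ hcpt π hπ
  obtain ⟨E, hE, S, hS, H, _, _, hH, Sop, θ, hθS, hθinj, x, hx, h⟩ := hreal n K hcpt π hπ
  haveI := hE
  haveI := hH
  exact heckeEigenvalue_mem_subfield_cofinite_of_semilinearAction π.1 E hS Sop θ hθS hθinj hx h

end Semilinear

/-! ### The degenerate rank `n = 0` (the trivial group): the only eigenvalue is `t_{v,0} = 1` -/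

section RankZero

/-- For `n = 0` the only Hecke eigenvalue read by the fact is `t_{v,0} = q_v^0 e_0(α) = 1`
(a private copy of the lemma of `ClozelAlgebraicityCMAssemblyProofs`, to keep the imports light).
[folklore] -/
private theorem heckeEigenvalueOf_rankZero_eq_one {K : Type} [Field K] [NumberField K]
    (v : HeightOneSpectrum (𝓞 K)) (α : Multiset ℂ) : heckeEigenvalueOf 0 v α 0 = 1 := by
  simp [heckeEigenvalueOf, Multiset.esymm, Multiset.powersetCard_zero_left]

/-- **`Clozel1990_heckeEigenvalueField` for `n = 0`** (its `n = 0` slice verbatim): `GL_0` is the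
trivial group and the only eigenvalue in the statement is `t_{v,0} = 1 ∈ ℚ`. (With
`Clozel1990_heckeEigenvalueField.rank_one` of `ClozelCArithmeticProofs` — Weil's theorem — the fact
is a theorem of the tree for `n ≤ 1`; `n ≥ 2` is Clozel's cohomological argument.) [folklore] -/
theorem Clozel1990_heckeEigenvalueField.rank_zero (K : Type) [Field K] [NumberField K]
    (hcpt : isCompact_glFiniteIntegralLevel 0 K) (π : CuspidalAutomorphicRepData 0 K hcpt) :
    ∃ E : Subfield ℂ, FiniteDimensional ℚ E ∧
      ∀ᶠ v : HeightOneSpectrum (𝓞 K) in Filter.cofinite, ∀ α : Multiset ℂ,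
        π.1.HasSatakeParamAt v α → ∀ i ≤ 0, heckeEigenvalueOf 0 v α i ∈ E := by
  obtain ⟨E, hE, -⟩ :=
    Literature.LinearAlgebra.BaseChange.exists_subfield_finiteDimensional_iff_mem
      (⊥ : IntermediateField ℚ ℂ)
  refine ⟨E, hE, Filter.Eventually.of_forall fun v α _ i hi ↦ ?_⟩
  obtain rfl : i = 0 := Nat.le_zero.mp hi
  rw [heckeEigenvalueOf_rankZero_eq_one]
  exact one_mem E

end RankZero

end Literature.NumberTheory.Automorphic

end
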